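import Literature.RingTheory.MvPolynomial.FormalCubeIntegral
import Mathlib.Data.Sym.Sym2
import Mathlib.Data.Finset.Sym
import Mathlib.RingTheory.MvPolynomial.Tower
import Mathlib.Data.Fin.Tuple.Basic
import Mathlib.Algebra.BigOperators.Fin
import Mathlib.Data.Fintype.Sum
import HarnessLib

/-!
# The Battle–Brydges–Federbush interpolation ("peeling") formula, algebraic form

Topic `Literature/Probability/LatticeModels` (cluster-expansion technology; consumed by the
fermionic tree expansion `MathematicalPhysics/QuantumLattice/FermionicTreeExpansion.lean`).

Let `ι` be a finite set of "points" (clusters) and `f` a polynomial in the *pair variables*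
`s_ℓ`, `ℓ ∈ Sym2 ι` (unordered pairs; the diagonal variables are allowed and are never
interpolated).  The Battle–Federbush / Brydges sequential interpolation (Battle–Federbush 1984;
Brydges 1986; in the form of Mastropietro 2008, §2.8, (2.83)–(2.98)) expands the value of `f` at
`s ≡ 1` by growing a set `X₁ = {root} ⊂ X₂ ⊂ ⋯` one point at a time: at step `m` the variables of
the pairs *crossing the boundary* of `X_{m+1} = {y₀, …, y_m}` are multiplied by a parameter `t_m`
and one integrates `∫₀¹ dt_m ∂/∂t_m`; the derivative picks a crossing pair `ℓ = {y_i, z}` (the new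
point `z = y_{m+1}` and its *parent* `y_i`), the value `t_m = 0` gives the *decoupled* term.  The
result is the **peeling formula** (`eval_one_eq_sum_term`):

`f(1) = Σ_{k < |ι|} Σ_{scripts s of length k+1} ∫_{[0,1]^ι} w_s(t) · (∂_{ℓ_k} ⋯ ∂_{ℓ_1} f)(σ_s(t)) dt`

summed over **scripts** `s` (a root-anchored injective sequence `y₀ = root, y₁, …, y_k` with a
parent index `i_j < j` for each `j ≥ 1`; lines `ℓ_j = {y_{i_j}, y_j}`), where, writing
`X_{m+1} = {y₀,…,y_m}` and `t_m = t_{y_m}` (the parameter of the `m`-th cut is indexed by the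
point `y_m`, so that all polynomials live in the one ring `MvPolynomial ι R`):

* the **interpolation point** `σ_s(ℓ) = ∏_{m < k : ℓ ∼ ∂X_{m+1}} t_{y_m}` for a pair `ℓ` inside
  `{y₀,…,y_k}` or disjoint from it, and `σ_s(ℓ) = 0` for a pair crossing `∂{y₀,…,y_k}`
  (`decPt`; Mastropietro's `t_{n'(ℓ)} ⋯ t_{n(ℓ)-1}`, (2.96)–(2.97), with the decoupling (2.90));
* the **weight** `w_s = ∏_{j=1}^{k} ∏_{m < j-1 : ℓ_j ∼ ∂X_{m+1}} t_{y_m}` (`weight`;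
  (2.92)–(2.93), i.e. `∏_m t_m^{b_m - 1}` in the notation of Lemma 2.3 there);
* `∫_{[0,1]^ι} dt` the formal cube integral (`Literature.RingTheory.MvPolynomial.cubeIntegral`).

Applied to `f = e^{-V}` / `det G(s)` (pair variables scaling the propagators between clusters)
this is the expansion behind the Brydges–Battle–Federbush / Gawedzki–Kupiainen–Lesniewski
determinant formula for truncated fermionic expectations (Mastropietro 2008, (2.99)–(2.118);
Benfatto–Giuliani–Mastropietro 2006, (2.66)).  Here the expansion is proved for an *arbitrary
polynomial* `f`, which is the honest algebraic content of the interpolation; the fermionic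
specialisation is done in `FermionicTreeExpansion.lean`.

## Main definitions (namespace `Literature.Probability.LatticeModels.BattleFederbush`)

* `Script root k` (inductive: `nil`, `snoc s i z`), `Script.y`, `Script.Valid` (injectivity),
  `Script.pre s m = {y₀,…,y_m}`, `crossB A ℓ` (a pair crosses `∂A`), `Script.cutExp`,
  `Script.livePt` / `fullPt` / `decPt` (the points `π_s`, `ρ_s`, `σ_s`), `Script.weight`,
  `Script.lines`, `Script.lineDeriv`, `Script.term`, `Script.liveTerm`.
* `eval_one_eq_sum_term` — the peeling formula; `liveTerm_eq` — one interpolation step.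

## Sources

G. A. Battle, P. Federbush, *A note on cluster expansions, tree graph identities, extra `1/N!`
factors!!!*, Lett. Math. Phys. 8 (1984) 55–57 (bib key `BattleFederbush1984`); D. C. Brydges,
*A short course on cluster expansions*, Les Houches 1984 (North-Holland, 1986) (bib key
`Brydges1986`); V. Mastropietro, *Non-Perturbative
Renormalization* (World Scientific, 2008), §2.8 "The Brydges–Battle–Federbush representation",
(2.83)–(2.98), PDF pp. 44–46 of the held copy `book:mastropietro2008-non-perturbative-renormalization`
(bib key `Mastropietro2008`); G. Benfatto, A. Giuliani, V. Mastropietro, Ann. Henri Poincaré 7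
(2006), (2.66) (bib key `BenfattoGiulianiMastropietro2006`).  The proof here is the book's
induction written for a general polynomial: one step is the formal fundamental theorem of
calculus in the newest parameter plus the chain rule (`liveTerm_eq`), and the steps telescope.
-/

noncomputable section

open MvPolynomial Finsupp Literature.RingTheory.MvPolynomial

namespace Literature.Probability.LatticeModels

namespace BattleFederbush

variable {ι : Type*}

/-! ### Iterated formal derivatives along a list of variables -/

section ListDeriv

variable {τ : Type*} {R : Type*} [CommRing R]

/-- The iterated formal partial derivative `∂_{ℓ_k} ⋯ ∂_{ℓ_1} F` along a list of variables
`[ℓ_1, …, ℓ_k]` (first variable differentiated first). [folklore] -/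
def listDeriv (L : List τ) (F : MvPolynomial τ R) : MvPolynomial τ R :=
  L.foldl (fun G ℓ => pderiv ℓ G) F

/-- No derivative. [folklore] -/
@[simp] theorem listDeriv_nil (F : MvPolynomial τ R) : listDeriv [] F = F := rfl

/-- Peeling the first derivative. [folklore] -/
@[simp] theorem listDeriv_cons (ℓ : τ) (L : List τ) (F : MvPolynomial τ R) :
    listDeriv (ℓ :: L) F = listDeriv L (pderiv ℓ F) := rfl

/-- Appending a last derivative. [folklore] -/
theorem listDeriv_append_singleton (L : List τ) (ℓ : τ) (F : MvPolynomial τ R) :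
    listDeriv (L ++ [ℓ]) F = pderiv ℓ (listDeriv L F) := by
  simp [listDeriv, List.foldl_append]

/-- Additivity. [folklore] -/
theorem listDeriv_add (L : List τ) (F G : MvPolynomial τ R) :
    listDeriv L (F + G) = listDeriv L F + listDeriv L G := by
  induction L generalizing F G with
  | nil => rfl
  | cons ℓ L ih => rw [listDeriv_cons, listDeriv_cons, listDeriv_cons, map_add, ih]

/-- `∂ 0 = 0`. [folklore] -/
@[simp] theorem listDeriv_zero (L : List τ) : listDeriv L (0 : MvPolynomial τ R) = 0 := by
  induction L with
  | nil => rfl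
  | cons ℓ L ih => rw [listDeriv_cons, map_zero, ih]

/-- Constants pass through. [folklore] -/
theorem listDeriv_C_mul (L : List τ) (a : R) (F : MvPolynomial τ R) :
    listDeriv L (C a * F) = C a * listDeriv L F := by
  induction L generalizing F with
  | nil => rfl
  | cons ℓ L ih => rw [listDeriv_cons, listDeriv_cons, pderiv_C_mul, ih]

/-- Finite sums pass through. [folklore] -/
theorem listDeriv_sum {α : Type*} (L : List τ) (t : Finset α) (F : α → MvPolynomial τ R) :
    listDeriv L (∑ a ∈ t, F a) = ∑ a ∈ t, listDeriv L (F a) := by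
  classical
  induction t using Finset.induction_on with
  | empty => simp
  | insert a t ha ih => rw [Finset.sum_insert ha, Finset.sum_insert ha, listDeriv_add, ih]

end ListDeriv

/-- A pair `ℓ = {a, b}` **crosses the boundary** of the set `A` iff exactly one of its endpoints
lies in `A` (Mastropietro 2008, after (2.83): "`ℓ ∼ ∂X`"). [folklore] -/
def crossB [DecidableEq ι] (A : Finset ι) : Sym2 ι → Bool :=
  Sym2.lift ⟨fun a b => xor (decide (a ∈ A)) (decide (b ∈ A)), fun _ _ => Bool.xor_comm _ _⟩

/-- `{a, b} ∼ ∂A` iff exactly one of `a`, `b` lies in `A`. [folklore] -/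
@[simp] theorem crossB_mk [DecidableEq ι] (A : Finset ι) (a b : ι) :
    crossB A s(a, b) = xor (decide (a ∈ A)) (decide (b ∈ A)) := rfl

/-- **Scripts** of the sequential interpolation: `nil` is the root alone (`X₁ = {root}`), and
`snoc s i z` adds the new point `z` with parent the `i`-th point of `s` (the line `{y_i, z}`
differentiated at this step) (Mastropietro 2008, §2.8: the sequences `X₁ ⊂ X₂ ⊂ ⋯` together with
the lines `ℓ₁, ℓ₂, …`). [folklore] -/
inductive Script (root : ι) : ℕ → Type _
  | nil : Script root 0
  | snoc {k : ℕ} (s : Script root k) (i : Fin (k + 1)) (z : ι) : Script root (k + 1)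

namespace Script

variable {root : ι}

/-- The points `y₀ = root, y₁, …, y_k` of a script, in order of appearance. [folklore] -/
def y : {k : ℕ} → Script root k → Fin (k + 1) → ι
  | _, nil => fun _ => root
  | _, snoc s _ z => Fin.snoc (y s) z

/-- A script is **valid** if its points are distinct (each new point is new). [folklore] -/
def Valid : {k : ℕ} → Script root k → Prop
  | _, nil => True
  | _, snoc s _ z => Valid s ∧ ∀ m, y s m ≠ z

/-- Validity is decidable. [folklore] -/
instance instDecidableValid [DecidableEq ι] : {k : ℕ} → (s : Script root k) → Decidable (Valid s)
  | _, nil => isTrue trivial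
  | _, snoc s _ z =>
    haveI : Decidable (Valid s) := instDecidableValid s
    inferInstanceAs (Decidable (Valid s ∧ ∀ m, y s m ≠ z))

/-- Scripts of length `k + 2` are exactly (script of length `k + 1`, parent index, new point).
[folklore] -/
def snocEquiv (root : ι) (k : ℕ) : Script root (k + 1) ≃ Script root k × Fin (k + 1) × ι where
  toFun s := match s with | snoc s i z => (s, i, z)
  invFun p := snoc p.1 p.2.1 p.2.2
  left_inv s := by cases s; rfl
  right_inv _ := rfl

/-- The only script of length one is the root. [folklore] -/
instance instSubsingletonZero : Subsingleton (Script root 0) :=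
  ⟨fun a b => by cases a; cases b; rfl⟩

/-- Scripts of each length form a finite type. [folklore] -/
instance instFintype [Fintype ι] : (k : ℕ) → Fintype (Script root k)
  | 0 => ⟨{nil}, fun s => by cases s; exact Finset.mem_singleton_self _⟩
  | k + 1 =>
    haveI : Fintype (Script root k) := instFintype k
    Fintype.ofEquiv _ (snocEquiv root k).symm

/-- The root script has the root as its only point. [folklore] -/
@[simp] theorem y_nil (m : Fin 1) : (nil : Script root 0).y m = root := rfl

/-- Old points are unchanged by `snoc`. [folklore] -/
@[simp] theorem y_snoc_castSucc {k : ℕ} (s : Script root k) (i : Fin (k + 1)) (z : ι) (m : Fin (k + 1)) :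
    (snoc s i z).y m.castSucc = s.y m := by
  simp [y]

/-- The new point is the last one. [folklore] -/
@[simp] theorem y_snoc_last {k : ℕ} (s : Script root k) (i : Fin (k + 1)) (z : ι) :
    (snoc s i z).y (Fin.last (k + 1)) = z := by
  simp [y]

/-- The root script is valid. [folklore] -/
@[simp] theorem valid_nil : (nil : Script root 0).Valid := trivial

/-- Validity of an extended script. [folklore] -/
theorem valid_snoc_iff {k : ℕ} (s : Script root k) (i : Fin (k + 1)) (z : ι) :
    (snoc s i z).Valid ↔ s.Valid ∧ ∀ m, s.y m ≠ z := Iff.rfl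

/-- The root is the first point. [folklore] -/
theorem y_zero : {k : ℕ} → (s : Script root k) → s.y 0 = root
  | _, nil => rfl
  | _, snoc s i z => by
    rw [← Fin.castSucc_zero, y_snoc_castSucc, y_zero s]

/-- The points of a valid script are distinct. [folklore] -/
theorem y_injective : {k : ℕ} → (s : Script root k) → s.Valid → Function.Injective s.y
  | _, nil => fun _ a b _ => Fin.ext (by have := a.isLt; have := b.isLt; omega)
  | _, snoc s i z => fun hv a b hab => by
    obtain ⟨hs, hz⟩ := hv
    induction a using Fin.lastCases with
    | last =>
      induction b using Fin.lastCases with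
      | last => rfl
      | cast b => rw [y_snoc_last, y_snoc_castSucc] at hab; exact absurd hab.symm (hz b)
    | cast a =>
      induction b using Fin.lastCases with
      | last => rw [y_snoc_last, y_snoc_castSucc] at hab; exact absurd hab (hz a)
      | cast b => rw [y_snoc_castSucc, y_snoc_castSucc] at hab; rw [y_injective s hs hab]

variable [DecidableEq ι]

/-- The prefix set `X_{m+1} = {y₀, …, y_m}` (all points if `m ≥ k`). [folklore] -/
def pre {k : ℕ} (s : Script root k) (m : ℕ) : Finset ι :=
  (Finset.univ.filter fun m' : Fin (k + 1) => (m' : ℕ) ≤ m).image s.y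

/-- Membership in a prefix set. [folklore] -/
theorem mem_pre {k : ℕ} (s : Script root k) (m : ℕ) (a : ι) :
    a ∈ s.pre m ↔ ∃ m' : Fin (k + 1), (m' : ℕ) ≤ m ∧ s.y m' = a := by
  simp [pre]

/-- The whole point set: `X_{k+1} = {y₀, …, y_k}`. [folklore] -/
theorem pre_eq_image {k : ℕ} (s : Script root k) {m : ℕ} (hm : k ≤ m) :
    s.pre m = Finset.univ.image s.y := by
  ext a
  simp only [mem_pre, Finset.mem_image, Finset.mem_univ, true_and]
  exact ⟨fun ⟨m', _, h⟩ => ⟨m', h⟩, fun ⟨m', h⟩ => ⟨m', (Nat.lt_succ_iff.1 m'.isLt).trans hm, h⟩⟩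

/-- Prefix sets are unchanged by adding a point at the end. [folklore] -/
theorem pre_snoc {k : ℕ} (s : Script root k) (i : Fin (k + 1)) (z : ι) {m : ℕ} (hm : m ≤ k) :
    (snoc s i z).pre m = s.pre m := by
  ext a
  simp only [mem_pre]
  constructor
  · rintro ⟨m', hm', rfl⟩
    induction m' using Fin.lastCases with
    | last => exact absurd (hm'.trans hm) (by simp)
    | cast m' => exact ⟨m', hm', by rw [y_snoc_castSucc]⟩
  · rintro ⟨m', hm', rfl⟩
    exact ⟨m'.castSucc, hm', by rw [y_snoc_castSucc]⟩

/-- A point of a valid script lies in the prefix set `X_{m+1}` iff its index is `≤ m`. [folklore] -/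
theorem y_mem_pre_iff {k : ℕ} (s : Script root k) (hs : s.Valid) (j : Fin (k + 1)) (m : ℕ) :
    s.y j ∈ s.pre m ↔ (j : ℕ) ≤ m := by
  rw [mem_pre]
  constructor
  · rintro ⟨m', hm', h⟩
    rwa [← y_injective s hs h]
  · exact fun h => ⟨j, h, rfl⟩

/-- The exponent vector of the interpolated value of the pair variable `s_ℓ` using the cuts
`m < n`: `Σ_{m < n : ℓ ∼ ∂X_{m+1}} e_{y_m}`, i.e. `s_ℓ ↦ ∏_{m < n : ℓ ∼ ∂X_{m+1}} t_{y_m}`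
(Mastropietro 2008, (2.86): `∏_k t_k(ℓ)`). [folklore] -/
def cutExp {k : ℕ} (s : Script root k) (n : ℕ) (ℓ : Sym2 ι) : ι →₀ ℕ :=
  ∑ m : Fin (k + 1), if (m : ℕ) < n ∧ crossB (s.pre m) ℓ = true then Finsupp.single (s.y m) 1 else 0

/-- Splitting off the last cut. [folklore] -/
theorem cutExp_succ_self {k : ℕ} (s : Script root k) (ℓ : Sym2 ι) :
    s.cutExp (k + 1) ℓ = s.cutExp k ℓ +
      if crossB (s.pre k) ℓ = true then Finsupp.single (s.y (Fin.last k)) 1 else 0 := by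
  unfold cutExp
  rw [Fin.sum_univ_castSucc, Fin.sum_univ_castSucc]
  have hlast : (if ((Fin.last k : Fin (k + 1)) : ℕ) < k ∧ crossB (s.pre (Fin.last k : Fin (k + 1))) ℓ = true
      then Finsupp.single (s.y (Fin.last k)) 1 else (0 : ι →₀ ℕ)) = 0 := by
    rw [if_neg]; simp
  rw [hlast, add_zero]
  congr 1
  · refine Finset.sum_congr rfl fun m _ => ?_
    have h1 : ((m.castSucc : Fin (k + 1)) : ℕ) < k + 1 := by
      have := m.isLt; simp only [Fin.val_castSucc]; omega
    have h2 : ((m.castSucc : Fin (k + 1)) : ℕ) < k := by simp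
    simp only [h1, h2, true_and]
  · simp only [Fin.val_last, Nat.lt_succ_self, true_and]

/-- The exponent vectors only involve the points of the script. [folklore] -/
theorem cutExp_apply_eq_zero {k : ℕ} (s : Script root k) (n : ℕ) (ℓ : Sym2 ι) {a : ι}
    (ha : ∀ m, s.y m ≠ a) : s.cutExp n ℓ a = 0 := by
  unfold cutExp
  rw [Finsupp.finsetSum_apply]
  refine Finset.sum_eq_zero fun m _ => ?_
  split_ifs
  · exact Finsupp.single_eq_of_ne (ha m).symm
  · rfl

/-- The cuts `m < k` do not involve the parameter of the last point. [folklore] -/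
theorem cutExp_apply_last {k : ℕ} (s : Script root k) (hs : s.Valid) (ℓ : Sym2 ι) :
    s.cutExp k ℓ (s.y (Fin.last k)) = 0 := by
  unfold cutExp
  rw [Finsupp.finsetSum_apply]
  refine Finset.sum_eq_zero fun m _ => ?_
  split_ifs with h
  · refine Finsupp.single_eq_of_ne fun hm => ?_
    have := y_injective s hs hm
    have h' : (m : ℕ) < k := h.1
    rw [← this] at h'
    simp at h'
  · rfl

/-- The cut exponents of the extended script (cuts `m ≤ k`) are those of the original one.
[folklore] -/
theorem cutExp_snoc {k : ℕ} (s : Script root k) (i : Fin (k + 1)) (z : ι) {n : ℕ} (hn : n ≤ k + 1)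
    (ℓ : Sym2 ι) : (snoc s i z).cutExp n ℓ = s.cutExp n ℓ := by
  unfold cutExp
  rw [Fin.sum_univ_castSucc]
  have hlast : ¬ (((Fin.last (k + 1) : Fin (k + 2)) : ℕ) < n) := by simp; omega
  rw [if_neg (fun h => hlast h.1), add_zero]
  refine Finset.sum_congr rfl fun m _ => ?_
  have hm : ((m.castSucc : Fin (k + 2)) : ℕ) = (m : ℕ) := by simp
  rw [hm, y_snoc_castSucc, pre_snoc s i z (Nat.lt_succ_iff.1 m.isLt)]

/-- The exponent vector of the **weight** `w_s = ∏_j ∏_{m < j-1 : ℓ_j ∼ ∂X_{m+1}} t_{y_m}`: when the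
point `z` with parent `y_i` is added to a script with `k + 1` points, the new line contributes
`∏_{m < k : {y_i, z} ∼ ∂X_{m+1}} t_{y_m}` (Mastropietro 2008, (2.92)–(2.98)). [folklore] -/
def wExp : {k : ℕ} → Script root k → (ι →₀ ℕ)
  | _, nil => 0
  | _, snoc (k := k) s i z => wExp s + s.cutExp k s(s.y i, z)

/-- The weight exponent only involves the points of the script. [folklore] -/
theorem wExp_apply_eq_zero : {k : ℕ} → (s : Script root k) → {a : ι} → (∀ m, s.y m ≠ a) → s.wExp a = 0
  | _, nil, _, _ => rfl
  | _, snoc s i z, a, ha => by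
    have ha' : ∀ m, s.y m ≠ a := fun m => by rw [← y_snoc_castSucc s i z]; exact ha _
    rw [wExp, Finsupp.add_apply, wExp_apply_eq_zero s ha', cutExp_apply_eq_zero s _ _ ha', add_zero]

/-- The weight does not involve the parameter of the last point. [folklore] -/
theorem wExp_apply_last : {k : ℕ} → (s : Script root k) → s.Valid → s.wExp (s.y (Fin.last k)) = 0
  | _, nil, _ => rfl
  | _, snoc s i z, hv => by
    rw [y_snoc_last, wExp, Finsupp.add_apply, wExp_apply_eq_zero s hv.2, cutExp_apply_eq_zero s _ _ hv.2,
      add_zero]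

/-- The lines `ℓ₁, …, ℓ_k` of a script (`ℓ_j = {parent of y_j, y_j}`), in order. [folklore] -/
def lines : {k : ℕ} → Script root k → List (Sym2 ι)
  | _, nil => []
  | _, snoc s i z => lines s ++ [s(s.y i, z)]

omit [DecidableEq ι] in
/-- The endpoints of the lines of a script are points of the script. [folklore] -/
theorem mem_image_of_mem_lines [DecidableEq ι] : {k : ℕ} → (s : Script root k) →
    ∀ ℓ ∈ s.lines, ∀ a ∈ ℓ, a ∈ Finset.univ.image s.y
  | _, nil => by simp [lines]
  | _, snoc s i z => by
    intro ℓ hℓ a ha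
    rw [lines, List.mem_append, List.mem_singleton] at hℓ
    rcases hℓ with hℓ | rfl
    · obtain ⟨m, -, hm⟩ := Finset.mem_image.1 (mem_image_of_mem_lines s ℓ hℓ a ha)
      exact Finset.mem_image.2 ⟨m.castSucc, Finset.mem_univ _, by rw [y_snoc_castSucc, hm]⟩
    · rcases Sym2.mem_iff.1 ha with rfl | rfl
      · exact Finset.mem_image.2 ⟨i.castSucc, Finset.mem_univ _, by rw [y_snoc_castSucc]⟩
      · exact Finset.mem_image.2 ⟨Fin.last _, Finset.mem_univ _, by rw [y_snoc_last]⟩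

omit [DecidableEq ι] in
/-- Every point but the root is an endpoint of some line (the one that added it). [folklore] -/
theorem exists_mem_lines : {k : ℕ} → (s : Script root k) → ∀ m : Fin (k + 1), m ≠ 0 →
    ∃ ℓ ∈ s.lines, s.y m ∈ ℓ
  | _, nil => fun m hm => absurd (Fin.ext (by have := m.isLt; omega)) hm
  | _, snoc s i z => fun m hm => by
    induction m using Fin.lastCases with
    | last =>
      exact ⟨s(s.y i, z), by simp [lines], by rw [y_snoc_last]; exact Sym2.mem_mk_right _ _⟩
    | cast m =>
      have hm' : m ≠ 0 := fun h => hm (by rw [h]; rfl)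
      obtain ⟨ℓ, hℓ, hmem⟩ := exists_mem_lines s m hm'
      exact ⟨ℓ, by rw [lines]; exact List.mem_append_left _ hℓ, by rwa [y_snoc_castSucc]⟩

/-- A pair disjoint from the point set crosses no cut. [folklore] -/
theorem cutExp_mk_eq_zero_of_notMem {k : ℕ} (s : Script root k) {a b : ι}
    (ha : a ∉ Finset.univ.image s.y) (hb : b ∉ Finset.univ.image s.y) (n : ℕ) :
    s.cutExp n s(a, b) = 0 := by
  unfold cutExp
  refine Finset.sum_eq_zero fun m _ => ?_
  have ha' : a ∉ s.pre m := fun h => ha (by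
    obtain ⟨m', -, h⟩ := (mem_pre s m a).1 h
    exact Finset.mem_image.2 ⟨m', Finset.mem_univ _, h⟩)
  have hb' : b ∉ s.pre m := fun h => hb (by
    obtain ⟨m', -, h⟩ := (mem_pre s m b).1 h
    exact Finset.mem_image.2 ⟨m', Finset.mem_univ _, h⟩)
  rw [if_neg]
  simp [ha', hb']

section Ring

variable {R : Type*} [CommRing R]

/-- The iterated derivative `∂_{ℓ_k} ⋯ ∂_{ℓ_1} F` along the lines of a script. [folklore] -/
def lineDeriv {k : ℕ} (s : Script root k) (F : MvPolynomial (Sym2 ι) R) : MvPolynomial (Sym2 ι) R :=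
  listDeriv (lines s) F

omit [DecidableEq ι] in
/-- `lineDeriv` is `listDeriv` along `lines`. [folklore] -/
theorem lineDeriv_eq {k : ℕ} (s : Script root k) (F : MvPolynomial (Sym2 ι) R) :
    s.lineDeriv F = listDeriv s.lines F := rfl

omit [DecidableEq ι] in
/-- No line, no derivative. [folklore] -/
@[simp] theorem lineDeriv_nil (F : MvPolynomial (Sym2 ι) R) : (nil : Script root 0).lineDeriv F = F := rfl

omit [DecidableEq ι] in
/-- The new line is differentiated last. [folklore] -/
@[simp] theorem lineDeriv_snoc {k : ℕ} (s : Script root k) (i : Fin (k + 1)) (z : ι)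
    (F : MvPolynomial (Sym2 ι) R) :
    (snoc s i z).lineDeriv F = pderiv s(s.y i, z) (s.lineDeriv F) := by
  rw [lineDeriv, lines, listDeriv_append_singleton, lineDeriv]

variable (R)

/-- The **live interpolation point** `π_s` (cuts `m < k`): `s_ℓ ↦ ∏_{m < k : ℓ ∼ ∂X_{m+1}} t_{y_m}`.
[folklore] -/
def livePt {k : ℕ} (s : Script root k) (ℓ : Sym2 ι) : MvPolynomial ι R := monomial (s.cutExp k ℓ) 1

/-- The **full interpolation point** `ρ_s` (cuts `m ≤ k`, the last one interpolating the boundary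
of the whole point set with the parameter `t_{y_k}`). [folklore] -/
def fullPt {k : ℕ} (s : Script root k) (ℓ : Sym2 ι) : MvPolynomial ι R := monomial (s.cutExp (k + 1) ℓ) 1

/-- The **decoupled interpolation point** `σ_s = ρ_s|_{t_{y_k} = 0}`: pairs crossing the boundary of
the point set are set to `0` (Mastropietro 2008, (2.90)). [folklore] -/
def decPt {k : ℕ} (s : Script root k) (ℓ : Sym2 ι) : MvPolynomial ι R :=
  if crossB (s.pre k) ℓ = true then 0 else livePt R s ℓ

/-- The **weight** `w_s = t^{wExp s}`. [folklore] -/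
def weight {k : ℕ} (s : Script root k) : MvPolynomial ι R := monomial s.wExp 1

/-- At the decoupled point a pair disjoint from the point set of the script is `1`. [folklore] -/
theorem decPt_mk_of_notMem {k : ℕ} (s : Script root k) {a b : ι}
    (ha : a ∉ Finset.univ.image s.y) (hb : b ∉ Finset.univ.image s.y) : decPt R s s(a, b) = 1 := by
  rw [decPt, if_neg, livePt, cutExp_mk_eq_zero_of_notMem s ha hb]
  · simp
  · rw [pre_eq_image s le_rfl, crossB_mk]
    simp [ha, hb]

/-- At the decoupled point a pair crossing the boundary of the point set of the script is `0`.
[folklore] -/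
theorem decPt_mk_of_mem_of_notMem {k : ℕ} (s : Script root k) {a b : ι}
    (ha : a ∈ Finset.univ.image s.y) (hb : b ∉ Finset.univ.image s.y) : decPt R s s(a, b) = 0 := by
  rw [decPt, if_pos]
  rw [pre_eq_image s le_rfl, crossB_mk]
  simp [ha, hb]

variable [Fintype ι] [Algebra ℚ R]

/-- The **term** of a script in the peeling formula:
`∫_{[0,1]^ι} w_s · (∂_{ℓ_k} ⋯ ∂_{ℓ_1} f)(σ_s) dt`. [folklore] -/
def term (f : MvPolynomial (Sym2 ι) R) {k : ℕ} (s : Script root k) : R :=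
  cubeIntegral ι R (weight R s * aeval (decPt R s) (s.lineDeriv f))

/-- The **live term** of a script (not yet decoupled):
`∫_{[0,1]^ι} w_s · (∂_{ℓ_k} ⋯ ∂_{ℓ_1} f)(π_s) dt`. [folklore] -/
def liveTerm (f : MvPolynomial (Sym2 ι) R) {k : ℕ} (s : Script root k) : R :=
  cubeIntegral ι R (weight R s * aeval (livePt R s) (s.lineDeriv f))

variable {R}

omit [Fintype ι] [Algebra ℚ R] in
/-- `ρ_s` splits off the last cut: `ρ_s(ℓ) = π_s(ℓ) · t_{y_k}` for `ℓ ∼ ∂X_{k+1}`, `= π_s(ℓ)` otherwise.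
[folklore] -/
theorem fullPt_eq {k : ℕ} (s : Script root k) (ℓ : Sym2 ι) :
    fullPt R s ℓ = if crossB (s.pre k) ℓ = true
      then monomial (s.cutExp k ℓ + Finsupp.single (s.y (Fin.last k)) 1) 1 else livePt R s ℓ := by
  rw [fullPt, cutExp_succ_self]
  split_ifs <;> simp [livePt]

omit [Algebra ℚ R] in
/-- `ρ_s|_{t_{y_k} = 1} = π_s`. [folklore] -/
theorem substAt_one_fullPt {k : ℕ} (s : Script root k) (hs : s.Valid) (ℓ : Sym2 ι) :
    substAt (s.y (Fin.last k)) 1 (fullPt R s ℓ) = livePt R s ℓ := by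
  have h0 := cutExp_apply_last s hs ℓ
  rw [fullPt_eq]
  split_ifs with h
  · rw [substAt_monomial, one_pow, mul_one, Finsupp.erase_add, Finsupp.erase_single, add_zero,
      Finsupp.erase_of_notMem_support (by simpa [Finsupp.mem_support_iff] using h0), livePt]
  · rw [livePt, substAt_monomial_of_eq_zero _ _ h0]

omit [Algebra ℚ R] in
/-- `ρ_s|_{t_{y_k} = 0} = σ_s`. [folklore] -/
theorem substAt_zero_fullPt {k : ℕ} (s : Script root k) (hs : s.Valid) (ℓ : Sym2 ι) :
    substAt (s.y (Fin.last k)) 0 (fullPt R s ℓ) = decPt R s ℓ := by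
  have h0 := cutExp_apply_last s hs ℓ
  rw [fullPt_eq, decPt]
  split_ifs with h
  · rw [substAt_monomial, Finsupp.add_apply, h0, Finsupp.single_eq_same, zero_add, pow_one, mul_zero,
      monomial_zero]
  · rw [livePt, substAt_monomial_of_eq_zero _ _ h0]

omit [Fintype ι] [Algebra ℚ R] in
/-- `∂_{t_{y_k}} ρ_s(ℓ) = π_s(ℓ)` for `ℓ ∼ ∂X_{k+1}` and `0` otherwise. [folklore] -/
theorem pderiv_fullPt {k : ℕ} (s : Script root k) (hs : s.Valid) (ℓ : Sym2 ι) :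
    pderiv (s.y (Fin.last k)) (fullPt R s ℓ) = if crossB (s.pre k) ℓ = true then livePt R s ℓ else 0 := by
  have h0 := cutExp_apply_last s hs ℓ
  rw [fullPt_eq]
  split_ifs with h
  · rw [pderiv_monomial, add_tsub_cancel_right, Finsupp.add_apply, h0, Finsupp.single_eq_same,
      zero_add, Nat.cast_one, mul_one, livePt]
  · rw [livePt, pderiv_monomial, h0, Nat.cast_zero, mul_zero, monomial_zero]

omit [Fintype ι] [Algebra ℚ R] in
/-- The live point of the extended script is the full point of the original one: `π_{s.snoc} = ρ_s`.
[folklore] -/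
theorem livePt_snoc {k : ℕ} (s : Script root k) (i : Fin (k + 1)) (z : ι) :
    livePt R (snoc s i z) = fullPt R s := by
  funext ℓ
  rw [livePt, fullPt, cutExp_snoc s i z le_rfl]

omit [Fintype ι] [Algebra ℚ R] in
/-- The weight of the extended script: `w_{s.snoc i z} = w_s · π_s({y_i, z})`. [folklore] -/
theorem weight_snoc {k : ℕ} (s : Script root k) (i : Fin (k + 1)) (z : ι) :
    weight R (snoc s i z) = weight R s * livePt R s s(s.y i, z) := by
  rw [weight, weight, livePt, monomial_mul, mul_one]
  rfl

/-- Summing over the pairs crossing the boundary of the point set `A = {y₀,…,y_k}` of a valid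
script = summing over (old point, new point). [folklore] -/
theorem sum_cross_eq {M : Type*} [AddCommMonoid M] {k : ℕ} (s : Script root k) (hs : s.Valid)
    (F : Sym2 ι → M) :
    ∑ ℓ, (if crossB (Finset.univ.image s.y) ℓ = true then F ℓ else 0) =
      ∑ j : Fin (k + 1), ∑ z ∈ (Finset.univ.image s.y)ᶜ, F s(s.y j, z) := by
  set A := Finset.univ.image s.y with hA
  have hyA : ∀ j, s.y j ∈ A := fun j => Finset.mem_image_of_mem _ (Finset.mem_univ j)
  rw [← Finset.sum_filter, ← Finset.sum_product' (f := fun j z => F s(s.y j, z)),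
    ← Finset.sum_image (g := fun p : Fin (k + 1) × ι => s(s.y p.1, p.2))]
  · refine Finset.sum_congr ?_ fun _ _ => rfl
    ext ℓ
    rw [Finset.mem_filter, Finset.mem_image]
    simp only [Finset.mem_univ, true_and, Finset.mem_product, Finset.mem_compl, Prod.exists]
    refine Sym2.inductionOn ℓ fun a b => ?_
    constructor
    · intro h
      rw [crossB_mk] at h
      by_cases ha : a ∈ A
      · have hb : b ∉ A := fun hb => by simp [ha, hb] at h
        obtain ⟨j, -, rfl⟩ := Finset.mem_image.1 ha
        exact ⟨j, b, hb, rfl⟩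
      · have hb : b ∈ A := by by_contra hb; simp [ha, hb] at h
        obtain ⟨j, -, rfl⟩ := Finset.mem_image.1 hb
        exact ⟨j, a, ha, Sym2.eq_swap⟩
    · rintro ⟨j, z, hz, h⟩
      rw [← h, crossB_mk]
      simp [hyA j, hz]
  · rintro ⟨j, z⟩ hjz ⟨j', z'⟩ hjz' h
    simp only [Finset.coe_product, Set.mem_prod, Finset.mem_coe, Finset.mem_univ, true_and,
      Finset.mem_compl] at hjz hjz'
    rcases Sym2.eq_iff.1 h with ⟨h1, h2⟩ | ⟨h1, h2⟩
    · exact Prod.ext (y_injective s hs h1) h2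
    · dsimp only at h1
      exact absurd (h1 ▸ hyA j) hjz'

/-- **One interpolation step** (Mastropietro 2008, (2.85)/(2.88)): for a valid script `s`,
`∫ w_s (∂^s f)(π_s) = ∫ w_s (∂^s f)(σ_s) + Σ_{j, z ∉ s} ∫ w_{s'} (∂^{s'} f)(π_{s'})`, `s' = s.snoc j z`
— write `π_s = ρ_s|_{t=1}`, `σ_s = ρ_s|_{t=0}` for the newest parameter `t = t_{y_k}`, apply the
formal fundamental theorem of calculus and the chain rule; `∂_t ρ_s(ℓ) ≠ 0` only for the pairs
`ℓ = {y_j, z}` crossing the boundary of the point set. [cite: Mastropietro2008, §2.8 (2.85)-(2.89)] -/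
theorem liveTerm_eq (f : MvPolynomial (Sym2 ι) R) {k : ℕ} (s : Script root k) (hs : s.Valid) :
    liveTerm R f s = term R f s +
      ∑ j : Fin (k + 1), ∑ z ∈ (Finset.univ.image s.y)ᶜ, liveTerm R f (snoc s j z) := by
  set v := s.y (Fin.last k) with hv
  set H := aeval (fullPt R s) (s.lineDeriv f) with hH
  have hlive : aeval (livePt R s) (s.lineDeriv f) = substAt v 1 H := by
    rw [hH, ← AlgHom.comp_apply, comp_aeval]
    exact congrArg (fun g => aeval g (s.lineDeriv f)) (funext fun ℓ => (substAt_one_fullPt s hs ℓ).symm)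
  have hdec : aeval (decPt R s) (s.lineDeriv f) = substAt v 0 H := by
    rw [hH, ← AlgHom.comp_apply, comp_aeval]
    exact congrArg (fun g => aeval g (s.lineDeriv f)) (funext fun ℓ => (substAt_zero_fullPt s hs ℓ).symm)
  have hstep : liveTerm R f s - term R f s = cubeIntegral ι R (weight R s * pderiv v H) := by
    rw [liveTerm, term, ← map_sub, ← mul_sub, hlive, hdec, weight]
    exact (cubeIntegral_monomial_mul_pderiv (wExp_apply_last s hs) 1 H).symm
  have hchain : pderiv v H = ∑ ℓ, (if crossB (Finset.univ.image s.y) ℓ = true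
      then aeval (fullPt R s) (pderiv ℓ (s.lineDeriv f)) * livePt R s ℓ else 0) := by
    rw [hH, derivation_algHom_apply]
    refine Finset.sum_congr rfl fun ℓ _ => ?_
    rw [aeval_X, pderiv_fullPt s hs, ← pre_eq_image s le_rfl]
    split_ifs <;> simp
  rw [← sub_eq_iff_eq_add', hstep, hchain, sum_cross_eq s hs, Finset.mul_sum, map_sum]
  refine Finset.sum_congr rfl fun j _ => ?_
  rw [Finset.mul_sum, map_sum]
  refine Finset.sum_congr rfl fun z _ => ?_
  rw [liveTerm, weight_snoc, livePt_snoc, lineDeriv_snoc]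
  congr 1
  ring

/-- Summing the live terms of the scripts of the next length = summing, over the valid scripts
`s`, the parent index `j` and the new point `z ∉ s`, the live term of `s.snoc j z`. [folklore] -/
theorem sum_liveTerm_succ (f : MvPolynomial (Sym2 ι) R) (k : ℕ) :
    ∑ s : Script root (k + 1), (if s.Valid then liveTerm R f s else 0) =
      ∑ s : Script root k, if s.Valid then
        ∑ j : Fin (k + 1), ∑ z ∈ (Finset.univ.image s.y)ᶜ, liveTerm R f (snoc s j z) else 0 := by
  rw [← (snocEquiv root k).symm.sum_comp, Fintype.sum_prod_type]
  refine Finset.sum_congr rfl fun s _ => ?_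
  rw [Fintype.sum_prod_type]
  simp only [snocEquiv, Equiv.coe_fn_symm_mk]
  split_ifs with hs
  · refine Finset.sum_congr rfl fun j _ => ?_
    rw [← Finset.sum_filter]
    refine Finset.sum_congr ?_ fun z _ => rfl
    ext z
    simp [valid_snoc_iff, hs]
  · refine Finset.sum_eq_zero fun j _ => Finset.sum_eq_zero fun z _ => ?_
    rw [if_neg (fun h => hs ((valid_snoc_iff s j z).1 h).1)]

/-- The telescoped expansion after `n` steps: `f(1) = Σ_{k<n} (decoupled terms of length k+1) +
(live terms of length n+1)`. [folklore] -/
theorem eval_one_eq_partial (f : MvPolynomial (Sym2 ι) R) (n : ℕ) :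
    eval (fun _ => (1 : R)) f =
      (∑ k ∈ Finset.range n, ∑ s : Script root k, if s.Valid then term R f s else 0) +
        ∑ s : Script root n, if s.Valid then liveTerm R f s else 0 := by
  induction n with
  | zero =>
    rw [Finset.range_zero, Finset.sum_empty, zero_add, Fintype.sum_subsingleton _ (nil : Script root 0),
      if_pos valid_nil, liveTerm, lineDeriv_nil]
    have h1 : livePt R (nil : Script root 0) = C ∘ fun _ => (1 : R) := by
      funext ℓ
      have h0 : (nil : Script root 0).cutExp 0 ℓ = 0 := by simp [cutExp]
      simp only [livePt, h0, Function.comp_apply, C_apply]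
    rw [h1, aeval_C_comp_left, weight, show (nil : Script root 0).wExp = 0 from rfl, ← C_apply, C_1, one_mul,
      cubeIntegral_C]
    rfl
  | succ n ih =>
    rw [ih, Finset.sum_range_succ, add_assoc, add_left_cancel_iff, sum_liveTerm_succ, ← Finset.sum_add_distrib]
    refine Finset.sum_congr rfl fun s _ => ?_
    split_ifs with hs
    · exact liveTerm_eq f s hs
    · rw [add_zero]

/-- **The Battle–Brydges–Federbush peeling formula** (algebraic form; Mastropietro 2008, §2.8,
(2.91)–(2.98), for a general polynomial in the pair variables instead of `e^{-V}`): the value of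
`f` at `s ≡ 1` is the sum over all valid scripts `s` (root-anchored injective sequences with parent
indices, at most `|ι|` points) of `∫_{[0,1]^ι} w_s(t) (∂_{ℓ_k} ⋯ ∂_{ℓ_1} f)(σ_s(t)) dt`, where at the
decoupled point `σ_s` the pair variables crossing the point set of `s` vanish, those inside are the
products `∏ t` of Mastropietro's (2.96)–(2.97) and those outside are `1`. [cite: Mastropietro2008, §2.8 (2.91)-(2.98)] -/
theorem eval_one_eq_sum_term (f : MvPolynomial (Sym2 ι) R) :
    eval (fun _ => (1 : R)) f =
      ∑ k ∈ Finset.range (Fintype.card ι), ∑ s : Script root k, if s.Valid then term R f s else 0 := by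
  rw [eval_one_eq_partial f (Fintype.card ι), add_eq_left]
  refine Finset.sum_eq_zero fun s _ => ?_
  rw [if_neg]
  intro hs
  have := Fintype.card_le_of_injective _ (y_injective s hs)
  simp at this

end Ring

end Script

end BattleFederbush

end Literature.Probability.LatticeModels
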